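import Summits.NavierStokesRegularity.NavierStokesRegularity.Theses.TypeICertificateLadder

/-!
# `RungReynoldsOne` (stmt-NavierStokesRegularity-2882): window and ceiling of the `L^q`-vorticity budget

Support lemmas (real arithmetic only) for the crux `TypeICertificateLadder.RungReynoldsOne`, extracted
from the crux work file `Cruxes/RungReynoldsOne/Disproof.lean` §(c) (cdisprove seat, gen 2). The
`L^q`-vorticity Grönwall budget of crux idea card `Cruxes/RungReynoldsOne/Ideas/ideas-2882-ideator3.md`
(card 1) closes rung `X_C` whenever `q(q−1)C²/4 < q − 3/2` for some admissible `q` (upper exponent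
from `d/dt‖ω‖_q^q ≤ q(q−1)‖u‖_∞²‖ω‖_q^q/(4ν)`, lower exponent from the Leray–Giga `L^r` rate at
`r = 3q/(3−q)`). These lemmas settle exactly which rungs that bookkeeping can reach, independently of
its analytic validity: at `C = 1` the window is `2 < q < 3`; `q = 2` (enstrophy) reaches exactly
`C < 1` and is saturated at the crux; over all `q > 1` the reach is `C < √6 − √2 ∈ (1.035, 1.036)`,
attained at `q* = (3+√3)/2`. Consequence for the ladder: the crux `C = 1` is inside with a 3.5 %
margin; no rung `C ≥ 1.036` is reachable this way.
-/

noncomputable section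

namespace Summit.NavierStokesRegularity.NavierStokesRegularity.Theorems.RungReynoldsOneNegative

open Set Filter Topology

/-- At the crux `C = 1` the budget closes exactly for `2 < q < 3`. -/
theorem budgetCloses_one_iff (q : ℝ) : (q * (q - 1) * (1 : ℝ) ^ 2 / 4 < q - 3 / 2) ↔ 2 < q ∧ q < 3 := by
  constructor
  · intro h
    have h' : (q - 2) * (q - 3) < 0 := by nlinarith
    constructor
    · by_contra h2
      have h2' : q ≤ 2 := not_lt.1 h2
      nlinarith [mul_nonneg_of_nonpos_of_nonpos (sub_nonpos.2 h2') (by linarith : q - 3 ≤ 0)]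
    · by_contra h3
      have h3' : 3 ≤ q := not_lt.1 h3
      nlinarith [mul_nonneg (by linarith : 0 ≤ q - 2) (sub_nonneg.2 h3')]
  · rintro ⟨h2, h3⟩
    nlinarith [mul_pos (sub_pos.2 h2) (sub_pos.2 h3)]

/-- The enstrophy budget (`q = 2`) closes exactly the rungs `C < 1` (planner RUNG_NOTE: "X_C for
every C < 1 is a two-line enstrophy-Grönwall × Leray-rate argument"); the crux sits exactly on
its boundary. -/
theorem budgetCloses_two_iff {C : ℝ} (hC : 0 ≤ C) : (2 * (2 - 1) * C ^ 2 / 4 < 2 - 3 / 2) ↔ C < 1 := by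
  constructor
  · intro h
    by_contra h1
    have h1' : 1 ≤ C := not_lt.1 h1
    nlinarith [mul_le_mul h1' h1' zero_le_one hC]
  · intro h
    nlinarith [mul_lt_mul'' h h hC hC]

/-- **Ceiling of the method.** For every `q > 1`, `4(q − 3/2)/(q(q−1)) ≤ 8 − 4√3`; hence if the
budget closes at rung `C` for some `q > 1` then `C² < 8 − 4√3`. -/
theorem budget_ratio_le (q : ℝ) (hq : 1 < q) :
    4 * (q - 3 / 2) / (q * (q - 1)) ≤ 8 - 4 * Real.sqrt 3 := by
  set s : ℝ := Real.sqrt 3 with hs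
  have hs3 : s ^ 2 = 3 := Real.sq_sqrt (by norm_num)
  have hs0 : 0 ≤ s := Real.sqrt_nonneg 3
  have hs2 : s < 2 := by
    have h4 : Real.sqrt 4 = 2 := by
      rw [show (4 : ℝ) = 2 ^ 2 by norm_num, Real.sqrt_sq (by norm_num)]
    rw [hs, ← h4]
    exact Real.sqrt_lt_sqrt (by norm_num) (by norm_num)
  have hqq : 0 < q * (q - 1) := mul_pos (by linarith) (by linarith)
  rw [div_le_iff₀ hqq]
  have key : (4 - 2 * s) * ((8 - 4 * s) * (q * (q - 1)) - 4 * (q - 3 / 2)) =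
      2 * ((4 - 2 * s) * q - (3 - s)) ^ 2 := by
    linear_combination (-2) * hs3
  have h42 : 0 < 4 - 2 * s := by linarith
  have hnonneg : 0 ≤ (8 - 4 * s) * (q * (q - 1)) - 4 * (q - 3 / 2) := by
    have h2 : 0 ≤ (4 - 2 * s) * ((8 - 4 * s) * (q * (q - 1)) - 4 * (q - 3 / 2)) := by
      rw [key]; positivity
    exact nonneg_of_mul_nonneg_right (by simpa [mul_comm] using h2) h42
  linarith

/-- If the budget closes at rung `C` for some `q > 1` then `C² < 8 − 4√3`. [folklore] -/
theorem sq_lt_of_budgetCloses {C q : ℝ} (hq : 1 < q) (h : q * (q - 1) * C ^ 2 / 4 < q - 3 / 2) :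
    C ^ 2 < 8 - 4 * Real.sqrt 3 := by
  have hqq : 0 < q * (q - 1) := mul_pos (by linarith) (by linarith)
  have h1 : C ^ 2 < 4 * (q - 3 / 2) / (q * (q - 1)) := by
    rw [lt_div_iff₀ hqq]
    nlinarith
  exact h1.trans_le (budget_ratio_le q hq)

/-- The ceiling is attained at `q* = (3 + √3)/2`. -/
theorem budget_ratio_at_qstar :
    4 * ((3 + Real.sqrt 3) / 2 - 3 / 2) / ((3 + Real.sqrt 3) / 2 * ((3 + Real.sqrt 3) / 2 - 1)) =
      8 - 4 * Real.sqrt 3 := by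
  set s : ℝ := Real.sqrt 3 with hs
  have hs3 : s ^ 2 = 3 := Real.sq_sqrt (by norm_num)
  have hs0 : 0 ≤ s := Real.sqrt_nonneg 3
  have hden : 0 < (3 + s) / 2 * ((3 + s) / 2 - 1) := mul_pos (by linarith) (by linarith)
  rw [div_eq_iff hden.ne']
  linear_combination (s + 2) * hs3

/-- `(√6 − √2)² = 8 − 4√3`: the ceiling constant is `√6 − √2`. -/
theorem sqrt_six_sub_sqrt_two_sq : (Real.sqrt 6 - Real.sqrt 2) ^ 2 = 8 - 4 * Real.sqrt 3 := by
  have h6 : Real.sqrt 6 ^ 2 = 6 := Real.sq_sqrt (by norm_num)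
  have h2 : Real.sqrt 2 ^ 2 = 2 := Real.sq_sqrt (by norm_num)
  have hab : Real.sqrt 6 * Real.sqrt 2 = 2 * Real.sqrt 3 := by
    rw [← Real.sqrt_mul (by norm_num) 2, show ((6 : ℝ) * 2) = (2 : ℝ) ^ 2 * 3 by norm_num,
      Real.sqrt_mul (by norm_num) 3, Real.sqrt_sq (by norm_num)]
  linear_combination h6 + h2 - 2 * hab

/-- Numerical bracket of the ceiling: `1.035 < √6 − √2 < 1.036` (so the crux `C = 1` is inside
the window with a 3.5 % margin, and rung `C = 1.036` is already outside). -/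
theorem sqrt_six_sub_sqrt_two_bounds :
    (1.035 : ℝ) < Real.sqrt 6 - Real.sqrt 2 ∧ Real.sqrt 6 - Real.sqrt 2 < 1.036 := by
  have h6l : (2.44948 : ℝ) < Real.sqrt 6 := (Real.lt_sqrt (by norm_num)).2 (by norm_num)
  have h6u : Real.sqrt 6 < (2.4495 : ℝ) := (Real.sqrt_lt' (by norm_num)).2 (by norm_num)
  have h2l : (1.41421 : ℝ) < Real.sqrt 2 := (Real.lt_sqrt (by norm_num)).2 (by norm_num)
  have h2u : Real.sqrt 2 < (1.41422 : ℝ) := (Real.sqrt_lt' (by norm_num)).2 (by norm_num)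
  constructor <;> linarith

/-- **Corollary (reach of the method).** If the card-1 budget closes at rung `C` for some
`q > 1`, then `C < √6 − √2 < 1.036`. -/
theorem lt_ceiling_of_budgetCloses {C q : ℝ} (hq : 1 < q) (h : q * (q - 1) * C ^ 2 / 4 < q - 3 / 2) :
    C < Real.sqrt 6 - Real.sqrt 2 := by
  have h1 := sq_lt_of_budgetCloses hq h
  rw [← sqrt_six_sub_sqrt_two_sq] at h1
  have hpos : 0 < Real.sqrt 6 - Real.sqrt 2 := by linarith [sqrt_six_sub_sqrt_two_bounds.1]
  exact lt_of_pow_lt_pow_left₀ 2 hpos.le h1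

/-- The crux is inside the window: the budget closes at `C = 1` for `q* = (3+√3)/2` (indeed for
every `q ∈ (2,3)`), with exponents `q*(q*−1)/4 = (3+2√3)/8 ≈ 0.808 < √3/2 ≈ 0.866 = q* − 3/2`. -/
theorem budgetCloses_one_qstar :
    (3 + Real.sqrt 3) / 2 * ((3 + Real.sqrt 3) / 2 - 1) * (1 : ℝ) ^ 2 / 4 < (3 + Real.sqrt 3) / 2 - 3 / 2 := by
  rw [budgetCloses_one_iff]
  have h3l : (1.7 : ℝ) < Real.sqrt 3 := (Real.lt_sqrt (by norm_num)).2 (by norm_num)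
  have h3u : Real.sqrt 3 < (1.8 : ℝ) := (Real.sqrt_lt' (by norm_num)).2 (by norm_num)
  constructor <;> linarith


/-- **Tightness of the enstrophy budget at the crux.** The model enstrophy `E(t) = (1−t)^{-1/2}`
satisfies the `q = 2`, `C = 1` Grönwall inequality `E′ ≤ C²E/(2(T−t))` WITH EQUALITY and at the
same time realises Leray's lower `H¹`-rate `E ≥ c (T−t)^{-1/2}` with equality: at `C = 1` the
enstrophy budget and the lower rate are compatible forever, so the `q = 2` argument proves nothing
at the crux without an extra input (the deficit/rigidity step of the planner's RUNG_NOTE, or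
`q > 2`). -/
theorem enstrophy_budget_saturated {t : ℝ} (ht : t < 1) :
    HasDerivAt (fun s : ℝ => (Real.sqrt (1 - s))⁻¹)
      ((1 : ℝ) ^ 2 * (Real.sqrt (1 - t))⁻¹ / (2 * (1 - t))) t := by
  have h1t : 0 < 1 - t := sub_pos.2 ht
  have hs : 0 < Real.sqrt (1 - t) := Real.sqrt_pos.2 h1t
  have h1 : HasDerivAt (fun s : ℝ => 1 - s) (-1) t := by
    have h := (hasDerivAt_id t).const_sub (1 : ℝ)
    simpa using h
  have h2 : HasDerivAt (fun s : ℝ => Real.sqrt (1 - s)) (1 / (2 * Real.sqrt (1 - t)) * (-1)) t :=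
    (Real.hasDerivAt_sqrt h1t.ne').comp t h1
  have h3 := h2.inv hs.ne'
  refine h3.congr_deriv ?_
  have hss : Real.sqrt (1 - t) ^ 2 = 1 - t := Real.sq_sqrt h1t.le
  field_simp
  rw [hss]


end Summit.NavierStokesRegularity.NavierStokesRegularity.Theorems.RungReynoldsOneNegative

end
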